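import Summits.AtomisticToContinuum.Crystallization.Theorems.OverbindingBudgetAffineRunCutBondCarry

/-!
# `OverbindingBudget` / crux `RobustDefectLimitWindows` (stmt-AtomisticToContinuum-31280) — «RunCut» part 23B-β «LEG»:
# A STAR LINE CARRIED ALONG A CHAIN OF BONDS — KILL OR CARRY

Support file (lens-4 g90; order of record (2c), `ρ₁ = 30`; memo `g90/memo/BONDCARRY-g90.md` §3 = the statement typed here; architecture
`g89/memo/ATLAS-STAR-g89.md` §1 (T) carry · (K1) first-foreign kill · (H) hub).  Part 23B-α `…RunCutBondCarry.carry_step` moves a carried star member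
across ONE bond at chord cost `33/10⁵`; this file iterates it along a GIVEN chain of first-shell registrations `c 0 → c 1 → … → c n` inside the chart
ball (`u t ∈ P_{c t}`, `‖u t‖ = 1`, `f_{c t}(u t) = y_{c (t+1)}` — exactly what `…RunCutLegCover.space_step` supplies), starting at an h-site `c 0`
with its own axis.  SOURCE of every constant: 23B-α (`33/10⁵` per bond from `hf`'s registrations and `bond_exact`'s scale window; `246/10⁵` from `hA`
through two own-face chords); nothing here reads a chart hypothesis directly except through 23B-α / the engine file's `unit_axis`.
* §1 glue: sign products, re-alignment through an exact `±` identity (`realign`), unit norms, one-bond compounding of the scale window, the fcc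
  star-pair law with EQUALITY (`XF_pairs_eq`: two fcc lines are the same up to sign or at model cosine `±1/3`), `fcc ≠ hcp` (private twin of
  `…CompressedCutSeed.fcc_ne_hcp`, which is not below this file's imports).
  Budgets of record as pure arithmetic: `cos_budget` (≤ 36 carried bonds fit under `c⋆ = 87/250`), `uniax_budget` (≤ 30 under `1/100`),
  `scale_budget` (≤ 35 bonds inside `[0.888, 1.04]`) — the walk of record (`≤ 17` per leg, `≤ 17` mover-offset bonds) is inside all three.
* §2 (section `Atlas`, the chart datum of parts 22A–23B-α verbatim) `bond_windows` (both one-bond scale windows, no carried data) and ★ `leg_scale` /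
  `leg_scale_end`: along the chain `(10⁴/10011)^t ν_{c 0} ≤ ν_{c t} ≤ (10011/10⁴)^t ν_{c 0}` and the same anchored at `c n` with exponent `n − t`
  (orientation-free, both bond windows; 23C feeds the exponents `≤ 35` to `scale_budget`).
* §3 ★★ `leg_carry` — KILL ∨ CARRY by induction on the chain length: either some h-site `c t` (`0 < t ≤ n`) sees a carried SIDE member, and then the two
  frame axes CROSS, `|⟪N_{c 0}, N_{c t}⟫| ≤ 1/3 + 246/10⁵ + t·33/10⁵` (`side_kill_cos` + `inner_near_axes`; with `t ≤ 17` this is `0.3414033 ≤ 87/250`, the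
  engine `no_crossing`'s `hc` — fired in 23C with the walk's distances), or the member is carried to `c n` within `n·33/10⁵` of `±N_{c 0}` AND every h-site
  met on the way is ALIGNED, `‖N_{c t} ∓ N_{c 0}‖ ≤ t·33/10⁵` (re-anchoring is free: at an h-site the carried axis member IS `±N`, `axis_unit_of_XHax`).
  ★ `hub_fcc_lines`: two members delivered to one fcc site are the same line up to sign, or read `|cos| ≤ 1/3 + 246/10⁵` (the hub dichotomy's input).
[this file: 0 definitions; imports `…RunCutBondCarry` (23B-α) only; standard axioms]
-/

namespace Summit.AtomisticToContinuum.Crystallization.Theorems.OverbindingBudgetAffineRunCutLeg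

open scoped InnerProductSpace
open Literature.Geometry.DiscreteGeometry
open Summit.AtomisticToContinuum.Crystallization.Theorems.OverbindingBudgetAffineCompressedCutKernel (T3 tsq tneg fccL hcpL)
open Summit.AtomisticToContinuum.Crystallization.Theorems.OverbindingBudgetAffineCompressedCutCharts
  (mv mv_tneg mv_injective norm_mv_eq_one_iff ListedBy listedBy_fcc listedBy_hcp)
open Summit.AtomisticToContinuum.Crystallization.Theorems.OverbindingBudgetAffineCompressedCutEstablish (bond_exact)
open Summit.AtomisticToContinuum.Crystallization.Theorems.OverbindingBudgetAffineRunCutSheetCrossing (unit_axis inner_near_axes axis_flip)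
open Summit.AtomisticToContinuum.Crystallization.Theorems.OverbindingBudgetAffineRunCutBondLink (norm_face_lower)
open Summit.AtomisticToContinuum.Crystallization.Theorems.OverbindingBudgetAffineRunCutStarKernel
open Summit.AtomisticToContinuum.Crystallization.Theorems.OverbindingBudgetAffineRunCutBondCarry

variable {N : ℕ}
local notation "E3" => EuclideanSpace ℝ (Fin 3)

/-! ## §1 Glue -/

/-- Product of two signs is a sign. [formal bookkeeping] -/
theorem sign_mul {τ σ : ℝ} (hτ : τ = 1 ∨ τ = -1) (hσ : σ = 1 ∨ σ = -1) : τ * σ = 1 ∨ τ * σ = -1 := by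
  rcases hτ with rfl | rfl <;> rcases hσ with rfl | rfl <;> norm_num

/-- Re-alignment through an EXACT `±` identity costs nothing: if `u = τ • nk` and `u` is within `b` of `σ • n₀`, then `nk` is within `b` of
`(τσ) • n₀`. (The re-anchor step of the walk: at an h-site the carried axis member is `±` the site's own frame axis.) [this file] -/
theorem realign {u nk n₀ : E3} {τ σ b : ℝ} (hτ : τ = 1 ∨ τ = -1) (hue : u = τ • nk) (h : ‖u - σ • n₀‖ ≤ b) :
    ‖nk - (τ * σ) • n₀‖ ≤ b := by
  rcases hτ with rfl | rfl
  · rw [one_smul] at hue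
    rw [one_mul, ← hue]
    exact h
  · rw [neg_one_smul] at hue
    have hnk : nk = -u := by rw [hue, neg_neg]
    have e : -u - (-1 * σ) • n₀ = -(u - σ • n₀) := by rw [neg_mul, one_mul, neg_smul]; abel
    rw [hnk, e, norm_neg]
    exact h

/-- A vector of norm at least `L > 0` normalises to a unit vector. [formal bookkeeping] -/
theorem norm_unit_of_lower {v : E3} {L : ℝ} (hL : 0 < L) (h : L ≤ ‖v‖) : ‖(‖v‖⁻¹) • v‖ = 1 := by
  have hne : ‖v‖ ≠ 0 := by intro h0; rw [h0] at h; linarith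
  rw [norm_smul, norm_inv, norm_norm, inv_mul_cancel₀ hne]

/-- One more bond on the scale ladder: both one-bond windows `ν' ≤ 1.0011 ν`, `ν ≤ 1.0011 ν'` compound the orientation-free window by one power.
[this file] -/
theorem window_succ {ν₀ ν ν' : ℝ} {t : ℕ} (h1 : (10000 / 10011 : ℝ) ^ t * ν₀ ≤ ν) (h2 : ν ≤ (10011 / 10000 : ℝ) ^ t * ν₀)
    (hhi : ν' ≤ 10011 / 10000 * ν) (hhi' : ν ≤ 10011 / 10000 * ν') :
    (10000 / 10011 : ℝ) ^ (t + 1) * ν₀ ≤ ν' ∧ ν' ≤ (10011 / 10000 : ℝ) ^ (t + 1) * ν₀ := by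
  constructor
  · have e : (10000 / 10011 : ℝ) ^ (t + 1) * ν₀ = 10000 / 10011 * ((10000 / 10011 : ℝ) ^ t * ν₀) := by ring
    have h3 : (10000 / 10011 : ℝ) * ((10000 / 10011 : ℝ) ^ t * ν₀) ≤ 10000 / 10011 * ν := mul_le_mul_of_nonneg_left h1 (by norm_num)
    rw [e]
    linarith
  · have e : (10011 / 10000 : ℝ) ^ (t + 1) * ν₀ = 10011 / 10000 * ((10011 / 10000 : ℝ) ^ t * ν₀) := by ring
    have h3 : (10011 / 10000 : ℝ) * ν ≤ 10011 / 10000 * ((10011 / 10000 : ℝ) ^ t * ν₀) := mul_le_mul_of_nonneg_left h2 (by norm_num)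
    rw [e]
    linarith

/-- One more bond at the END of the scale ladder (anchor moved to the new site): windows of `ν_t` relative to `ν_n` become windows relative to
`ν_{n+1}` one power weaker. [this file] -/
theorem window_pred {νt ν ν' : ℝ} {s : ℕ} (h1 : (10000 / 10011 : ℝ) ^ s * ν ≤ νt) (h2 : νt ≤ (10011 / 10000 : ℝ) ^ s * ν)
    (hhi : ν' ≤ 10011 / 10000 * ν) (hhi' : ν ≤ 10011 / 10000 * ν') :
    (10000 / 10011 : ℝ) ^ (s + 1) * ν' ≤ νt ∧ νt ≤ (10011 / 10000 : ℝ) ^ (s + 1) * ν' := by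
  have ha : (0 : ℝ) ≤ (10000 / 10011 : ℝ) ^ s := pow_nonneg (by norm_num) s
  have hb : (0 : ℝ) ≤ (10011 / 10000 : ℝ) ^ s := pow_nonneg (by norm_num) s
  constructor
  · have e : (10000 / 10011 : ℝ) ^ (s + 1) * ν' = (10000 / 10011 : ℝ) ^ s * (10000 / 10011 * ν') := by ring
    have h3 : (10000 / 10011 : ℝ) ^ s * (10000 / 10011 * ν') ≤ (10000 / 10011 : ℝ) ^ s * ν := mul_le_mul_of_nonneg_left (by linarith) ha
    rw [e]
    linarith
  · have e : (10011 / 10000 : ℝ) ^ (s + 1) * ν' = (10011 / 10000 : ℝ) ^ s * (10011 / 10000 * ν') := by ring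
    have h3 : (10011 / 10000 : ℝ) ^ s * ν ≤ (10011 / 10000 : ℝ) ^ s * (10011 / 10000 * ν') := mul_le_mul_of_nonneg_left hhi' hb
    rw [e]
    linarith

/-! ### Budgets of record (pure arithmetic; `α = 246/10⁵`, `κ_b = 33/10⁵`, `c⋆ = 87/250`, engine windows `lo = 0.888`, `hi = 1.04`) -/

/-- KILL / HUB budget: up to `36` carried bonds in total fit under the engine's cosine cap `c⋆ = 87/250` (`1/3 + 246/10⁵ + 36·33/10⁵ = 0.3476733`;
the walk of record uses `t ≤ 17` per leg, two legs `≤ 34`). [this file] -/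
theorem cos_budget {t t' : ℕ} (h : t + t' ≤ 36) : 1 / 3 + 246 / 10 ^ 5 + (t : ℝ) * (33 / 10 ^ 5) + (t' : ℝ) * (33 / 10 ^ 5) ≤ 87 / 250 := by
  have h' := (Nat.cast_le (α := ℝ)).2 h
  push_cast at h'
  linarith

/-- UNIAXIALITY budget: up to `30` carried bonds keep a delivered line within `1/100` of the source axis (`30·33/10⁵ = 0.0099`; record `t ≤ 17` gives
`0.00561`). [this file] -/
theorem uniax_budget {t : ℕ} (h : t ≤ 30) : (t : ℝ) * (33 / 10 ^ 5) ≤ 1 / 100 := by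
  have h' := (Nat.cast_le (α := ℝ)).2 h
  push_cast at h'
  linarith

/-- SCALE budget: up to `35` bonds keep the nearest-neighbour distance inside the engine's window `[0.888, 1.04]`
(`(10011/10⁴)^35 = 1.0392…` — `36` would leave it — and `(10⁴/10011)^35 = 0.9622…`; record: `≤ 17` leg bonds + `≤ 17` mover-offset bonds). [this file] -/
theorem scale_budget {s : ℕ} (h : s ≤ 35) : 888 / 1000 ≤ (10000 / 10011 : ℝ) ^ s ∧ (10011 / 10000 : ℝ) ^ s ≤ 104 / 100 := by
  constructor
  · have h35 : (888 / 1000 : ℝ) ≤ (10000 / 10011 : ℝ) ^ 35 := by norm_num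
    exact h35.trans (pow_le_pow_of_le_one (by norm_num) (by norm_num) h)
  · have h35 : (10011 / 10000 : ℝ) ^ 35 ≤ 104 / 100 := by norm_num
    exact (pow_le_pow_right₀ (by norm_num) h).trans h35

/-- The fcc star-pair law WITH EQUALITY: two members of `XF` are the same line up to sign, or at model cosine `±1/3` (`tdot = ±144`). [this file, by `decide`] -/
theorem XF_pairs_eq : ∀ X ∈ XF, ∀ X' ∈ XF, X' = X ∨ X' = tneg X ∨ tdot X X' = 144 ∨ tdot X X' = -144 := by decide

/-- The opposite member reads the opposite unit vector. [formal bookkeeping] -/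
theorem unit_third_tneg (A : E3 →ₗ[ℝ] E3) (X : T3) :
    (‖A ((1 / 3 : ℝ) • mv (tneg X))‖⁻¹) • A ((1 / 3 : ℝ) • mv (tneg X)) = -((‖A ((1 / 3 : ℝ) • mv X)‖⁻¹) • A ((1 / 3 : ℝ) • mv X)) := by
  rw [mv_tneg, smul_neg, map_neg, unit_smul_neg]

/-- The two model patterns differ (`mv (0,0,−6)` is fcc-listed, not hcp-listed). [private twin of `…CompressedCutSeed.fcc_ne_hcp`, not importable here] -/
private theorem fcc_ne_hcp' : fccTwoShellPattern ≠ hcpTwoShellPattern := by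
  intro h
  have h1 : mv (0, 0, -6) ∈ fccTwoShellPattern := listedBy_fcc.2 _ (by decide)
  rw [h] at h1
  obtain ⟨W, hW, hW'⟩ := listedBy_hcp.1 _ h1
  have hW0 : W = (0, 0, -6) := mv_injective hW'.symm
  rw [hW0] at hW
  exact absurd hW (by decide)

section Atlas
/-! ONE chart datum on the ball `B(y j, ρ₁ ν_j)` (verbatim §2 of part 22A). -/
variable {y : Fin N → E3} (hy : Function.Injective y) {j : Fin N} {ρ₁ : ℝ}
  {Ac : Fin N → (E3 →ₗ[ℝ] E3)} {Qc : Fin N → (E3 →ₗᵢ[ℝ] E3)} {Pc : Fin N → Finset E3} {fc : Fin N → E3 → E3}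
  (hP : ∀ i, dist (y i) (y j) ≤ ρ₁ * nearestDist y j → Pc i = fccTwoShellPattern ∨ Pc i = hcpTwoShellPattern)
  (hA : ∀ i, dist (y i) (y j) ≤ ρ₁ * nearestDist y j → ∀ v ∈ Pc i, ‖Ac i v - Qc i v‖ ≤ 1 / 1000)
  (hf : ∀ i, dist (y i) (y j) ≤ ρ₁ * nearestDist y j → ∀ v ∈ Pc i,
    fc i v ∈ Set.range y ∧ dist (fc i v) (y i + nearestDist y i • Ac i v) ≤ 1 / 10 ^ 4 * nearestDist y i)
  (hinj : ∀ i, dist (y i) (y j) ≤ ρ₁ * nearestDist y j → Set.InjOn (fc i) ↑(Pc i))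
  (hex : ∀ i, dist (y i) (y j) ≤ ρ₁ * nearestDist y j → ∀ k : Fin N, k ≠ i →
    dist (y k) (y i) ≤ (3 / 2 + 1 / 450) * nearestDist y i → ∃ v ∈ Pc i, fc i v = y k)

include hy hP hA hf hinj hex

/-! ## §2 Scale along a chain -/

/-- ★ Both one-bond scale windows of a first-shell registration `u ∈ P_p`, `f_p u = y k` (no carried data): `bond_exact` forward and, through the exact
dictionary's back-pointer `w₀ ∈ P_k` (`f_k w₀ = y p`, `‖w₀‖ = 1`), backward. [this file] -/
theorem bond_windows {p k : Fin N} (hp : dist (y p) (y j) ≤ ρ₁ * nearestDist y j) (hk : dist (y k) (y j) ≤ ρ₁ * nearestDist y j)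
    {u : E3} (hu : u ∈ Pc p) (hu1 : ‖u‖ = 1) (hfu : fc p u = y k) :
    k ≠ p ∧ (9967 / 10000 * nearestDist y p ≤ nearestDist y k ∧ nearestDist y k ≤ 10011 / 10000 * nearestDist y p) ∧
      (9967 / 10000 * nearestDist y k ≤ nearestDist y p ∧ nearestDist y p ≤ 10011 / 10000 * nearestDist y k) := by
  obtain ⟨hkp, hlo, hhi, R₁, -, hD⟩ := bond_exact hy hP hA hf hinj hex hp hk hu hu1 hfu
  obtain ⟨w₀, hw₀, hfw₀, hRw₀⟩ := hD.1
  have hw₀1 : ‖w₀‖ = 1 := by rw [← R₁.norm_map w₀, hRw₀, norm_neg, hu1]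
  obtain ⟨-, hlo', hhi', -⟩ := bond_exact hy hP hA hf hinj hex hk hp hw₀ hw₀1 hfw₀
  exact ⟨hkp, ⟨hlo, hhi⟩, ⟨hlo', hhi'⟩⟩

/-- ★ **SCALE ALONG A CHAIN** (orientation-free): along first-shell registrations `c 0 → … → c n` inside the ball,
`(10⁴/10011)^t · ν_{c 0} ≤ ν_{c t} ≤ (10011/10⁴)^t · ν_{c 0}` for every `t ≤ n`, and consecutive sites differ. [this file] -/
theorem leg_scale (c : ℕ → Fin N) (u : ℕ → E3) :
    ∀ n : ℕ, (∀ t ≤ n, dist (y (c t)) (y j) ≤ ρ₁ * nearestDist y j) →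
      (∀ t < n, u t ∈ Pc (c t) ∧ ‖u t‖ = 1 ∧ fc (c t) (u t) = y (c (t + 1))) →
      ∀ t ≤ n, (10000 / 10011 : ℝ) ^ t * nearestDist y (c 0) ≤ nearestDist y (c t) ∧
        nearestDist y (c t) ≤ (10011 / 10000 : ℝ) ^ t * nearestDist y (c 0) ∧ (0 < t → c t ≠ c (t - 1)) := by
  intro n
  induction n with
  | zero =>
    intro _ _ t ht
    obtain rfl : t = 0 := Nat.le_zero.1 ht
    simp
  | succ n ih =>
    intro hball hch t ht
    have ih' := ih (fun s hs => hball s (by omega)) (fun s hs => hch s (by omega))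
    rcases Nat.lt_or_eq_of_le ht with hlt | rfl
    · exact ih' t (by omega)
    · obtain ⟨h1, h2, -⟩ := ih' n le_rfl
      obtain ⟨hu, hu1, hfu⟩ := hch n (by omega)
      obtain ⟨hne, ⟨-, hhi⟩, ⟨-, hhi'⟩⟩ := bond_windows hy hP hA hf hinj hex (hball n (by omega)) (hball (n + 1) le_rfl) hu hu1 hfu
      obtain ⟨hl, hr⟩ := window_succ h1 h2 hhi hhi'
      exact ⟨hl, hr, fun _ => by simpa using hne⟩

/-- ★ **SCALE ALONG A CHAIN, ANCHORED AT THE END**: `(10⁴/10011)^(n−t) · ν_{c n} ≤ ν_{c t} ≤ (10011/10⁴)^(n−t) · ν_{c n}` for every `t ≤ n`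
(the window a kill site `c t` needs relative to the hub end of its leg). [this file] -/
theorem leg_scale_end (c : ℕ → Fin N) (u : ℕ → E3) :
    ∀ n : ℕ, (∀ t ≤ n, dist (y (c t)) (y j) ≤ ρ₁ * nearestDist y j) →
      (∀ t < n, u t ∈ Pc (c t) ∧ ‖u t‖ = 1 ∧ fc (c t) (u t) = y (c (t + 1))) →
      ∀ t ≤ n, (10000 / 10011 : ℝ) ^ (n - t) * nearestDist y (c n) ≤ nearestDist y (c t) ∧
        nearestDist y (c t) ≤ (10011 / 10000 : ℝ) ^ (n - t) * nearestDist y (c n) := by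
  intro n
  induction n with
  | zero =>
    intro _ _ t ht
    obtain rfl : t = 0 := Nat.le_zero.1 ht
    simp
  | succ n ih =>
    intro hball hch t ht
    rcases Nat.lt_or_eq_of_le ht with hlt | rfl
    · obtain ⟨h1, h2⟩ := ih (fun s hs => hball s (by omega)) (fun s hs => hch s (by omega)) t (by omega)
      obtain ⟨hu, hu1, hfu⟩ := hch n (by omega)
      obtain ⟨-, ⟨-, hhi⟩, ⟨-, hhi'⟩⟩ := bond_windows hy hP hA hf hinj hex (hball n (by omega)) (hball (n + 1) le_rfl) hu hu1 hfu
      have e : n + 1 - t = (n - t) + 1 := by omega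
      rw [e]
      exact window_pred h1 h2 hhi hhi'
    · simp

/-! ## §3 Kill or carry -/

/-- ★★ **LEG CARRY — KILL ∨ CARRY.**  Along a chain of first-shell registrations `c 0 → c 1 → … → c n` inside the chart ball, starting at an h-site
`c 0` (frame axis `N_{c 0}`; `N_i := unit(A_i((√18)⁻¹(4,4,4)))` passed as the hypothesis-function `nA`): EITHER some h-site `c t`, `0 < t ≤ n`, receives a
carried SIDE member — then the two frame axes cross, `|⟪N_{c 0}, N_{c t}⟫| ≤ 1/3 + 246/10⁵ + t·33/10⁵` (the engine's `hc`) — OR every h-site met is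
ALIGNED with `c 0` up to `t·33/10⁵` and the walk holds at `c n` a member `X` of the invariant («fcc ∧ `X ∈ XF`» or «hcp ∧ `X ∈ XHax`») whose physical
unit vector is within `n·33/10⁵` of `±N_{c 0}`.  Induction on `n`: `carry_step` (23B-α) + `XH_dichotomy` + `axis_unit_of_XHax` (re-anchor, exact) /
`side_kill_cos` + `inner_near_axes` (kill). [this file] -/
theorem leg_carry (c : ℕ → Fin N) (u : ℕ → E3) {nA : Fin N → E3}
    (hnA : ∀ i, nA i = (‖Ac i ((Real.sqrt 18)⁻¹ • intVec ![4, 4, 4])‖⁻¹) • Ac i ((Real.sqrt 18)⁻¹ • intVec ![4, 4, 4]))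
    (h0 : Pc (c 0) = hcpTwoShellPattern) :
    ∀ n : ℕ, (∀ t ≤ n, dist (y (c t)) (y j) ≤ ρ₁ * nearestDist y j) →
      (∀ t < n, u t ∈ Pc (c t) ∧ ‖u t‖ = 1 ∧ fc (c t) (u t) = y (c (t + 1))) →
      (∃ t, 0 < t ∧ t ≤ n ∧ Pc (c t) = hcpTwoShellPattern ∧ |⟪nA (c 0), nA (c t)⟫_ℝ| ≤ 1 / 3 + 246 / 10 ^ 5 + t * (33 / 10 ^ 5)) ∨
      ((∀ t ≤ n, Pc (c t) = hcpTwoShellPattern → ∃ σ : ℝ, (σ = 1 ∨ σ = -1) ∧ ‖nA (c t) - σ • nA (c 0)‖ ≤ t * (33 / 10 ^ 5)) ∧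
        ∃ X : T3, ((Pc (c n) = fccTwoShellPattern ∧ X ∈ XF) ∨ (Pc (c n) = hcpTwoShellPattern ∧ X ∈ XHax)) ∧
          ∃ σ : ℝ, (σ = 1 ∨ σ = -1) ∧
            ‖(‖Ac (c n) ((1 / 3 : ℝ) • mv X)‖⁻¹) • Ac (c n) ((1 / 3 : ℝ) • mv X) - σ • nA (c 0)‖ ≤ n * (33 / 10 ^ 5)) := by
  intro n
  induction n with
  | zero =>
    intro _ _
    right
    have hax : ((12 : ℤ), (12 : ℤ), (12 : ℤ)) ∈ XHax := by decide
    obtain ⟨σ, hσ, hu⟩ := axis_unit_of_XHax hax (Ac (c 0))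
    refine ⟨fun t ht _ => ?_, (12, 12, 12), Or.inr ⟨h0, hax⟩, σ, hσ, ?_⟩
    · obtain rfl : t = 0 := Nat.le_zero.1 ht
      exact ⟨1, Or.inl rfl, by simp⟩
    · rw [hu, ← hnA]
      simp
  | succ n ih =>
    intro hball hch
    rcases ih (fun s hs => hball s (by omega)) (fun s hs => hch s (by omega)) with ⟨t, ht0, htn, hPt, hcos⟩ | ⟨halign, X, hinv, σ, hσ, hdist⟩
    · exact Or.inl ⟨t, ht0, by omega, hPt, hcos⟩
    · obtain ⟨hu, hu1, hfu⟩ := hch n (by omega)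
      have hp := hball n (by omega)
      have hk := hball (n + 1) le_rfl
      obtain ⟨-, -, -, Y, hY, hb⟩ := carry_step hy hP hA hf hinj hex hp hk hinv hu hu1 hfu
      -- the accumulated chord after this bond
      have hdist' : ‖(‖Ac (c (n + 1)) ((1 / 3 : ℝ) • mv Y)‖⁻¹) • Ac (c (n + 1)) ((1 / 3 : ℝ) • mv Y) - σ • nA (c 0)‖ ≤
          ((n + 1 : ℕ) : ℝ) * (33 / 10 ^ 5) := by
        have e : (‖Ac (c (n + 1)) ((1 / 3 : ℝ) • mv Y)‖⁻¹) • Ac (c (n + 1)) ((1 / 3 : ℝ) • mv Y) - σ • nA (c 0) =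
            ((‖Ac (c (n + 1)) ((1 / 3 : ℝ) • mv Y)‖⁻¹) • Ac (c (n + 1)) ((1 / 3 : ℝ) • mv Y) -
              (‖Ac (c n) ((1 / 3 : ℝ) • mv X)‖⁻¹) • Ac (c n) ((1 / 3 : ℝ) • mv X)) +
            ((‖Ac (c n) ((1 / 3 : ℝ) • mv X)‖⁻¹) • Ac (c n) ((1 / 3 : ℝ) • mv X) - σ • nA (c 0)) := by abel
        rw [e]
        refine (norm_add_le _ _).trans ?_
        push_cast
        linarith
      -- the alignment clause extends to `t ≤ n + 1` once the new site is handled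
      have halign' : (Pc (c (n + 1)) = hcpTwoShellPattern → ∃ τ : ℝ, (τ = 1 ∨ τ = -1) ∧
          ‖nA (c (n + 1)) - τ • nA (c 0)‖ ≤ ((n + 1 : ℕ) : ℝ) * (33 / 10 ^ 5)) →
          ∀ t ≤ n + 1, Pc (c t) = hcpTwoShellPattern → ∃ σ : ℝ, (σ = 1 ∨ σ = -1) ∧ ‖nA (c t) - σ • nA (c 0)‖ ≤ t * (33 / 10 ^ 5) := by
        intro hnew t ht hPt
        rcases Nat.lt_or_eq_of_le ht with hlt | rfl
        · exact halign t (by omega) hPt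
        · exact hnew hPt
      rcases hY with ⟨hPk, hYF⟩ | ⟨hPk, hYH⟩
      · -- fcc child: carry on any of its four lines
        right
        exact ⟨halign' fun hPh => absurd (hPk.symm.trans hPh) fcc_ne_hcp', Y, Or.inl ⟨hPk, hYF⟩, σ, hσ, hdist'⟩
      · rcases XH_dichotomy Y hYH with hYax | hside
        · -- hcp child on its AXIS: re-anchor (exact), carry on
          right
          refine ⟨halign' fun _ => ?_, Y, Or.inr ⟨hPk, hYax⟩, σ, hσ, hdist'⟩
          obtain ⟨τ, hτ, hue⟩ := axis_unit_of_XHax hYax (Ac (c (n + 1)))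
          rw [← hnA] at hue
          exact ⟨τ * σ, sign_mul hτ hσ, realign hτ hue hdist'⟩
        · -- hcp child seeing a SIDE member: the axes cross
          left
          refine ⟨n + 1, by omega, le_rfl, hPk, ?_⟩
          have hLk : ListedBy (Pc (c (n + 1))) hcpL := by rw [hPk]; exact listedBy_hcp
          have hkill := side_kill_cos hA hk hPk hYH hside
          rw [← hnA] at hkill
          obtain ⟨hN1, -⟩ := unit_axis hy hA hf hinj hex hk hPk
          rw [← hnA] at hN1
          have hu'1 : ‖(‖Ac (c (n + 1)) ((1 / 3 : ℝ) • mv Y)‖⁻¹) • Ac (c (n + 1)) ((1 / 3 : ℝ) • mv Y)‖ = 1 :=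
            norm_unit_of_lower (by norm_num) (norm_face_lower (frame_star_close (hA _ hk) hLk (List.all_eq_true.1 ownFace_table.2 Y hYH))
              (norm_third_mv_sq (star_lists_shape.2.1 Y hYH)))
          have h0' : ‖nA (c (n + 1)) - (1 : ℝ) • nA (c (n + 1))‖ ≤ 0 := by simp
          have := inner_near_axes hu'1 hN1 hσ (Or.inl rfl) (axis_flip hσ hdist') h0' hkill
          push_cast at this ⊢
          linarith

omit hy hP hf hinj hex in
/-- ★ **TWO LEGS AT AN fcc HUB.**  Two members `X, X′ ∈ XF` delivered to one fcc site `i` of the ball are the SAME line up to sign (`X′ = X` or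
`X′ = −X`: then their unit vectors are equal up to sign — alignment through the hub), or they read `|⟪û, û′⟫| ≤ 1/3 + 246/10⁵` (then the two source
h-sites' axes cross within `1/3 + 246/10⁵ + (t + t′)·33/10⁵` by `inner_near_axes` and the engine kills them). [this file] -/
theorem hub_fcc_lines {i : Fin N} (hi : dist (y i) (y j) ≤ ρ₁ * nearestDist y j) (hPi : Pc i = fccTwoShellPattern) {X X' : T3}
    (hX : X ∈ XF) (hX' : X' ∈ XF) :
    ((‖Ac i ((1 / 3 : ℝ) • mv X')‖⁻¹) • Ac i ((1 / 3 : ℝ) • mv X') = (‖Ac i ((1 / 3 : ℝ) • mv X)‖⁻¹) • Ac i ((1 / 3 : ℝ) • mv X) ∨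
      (‖Ac i ((1 / 3 : ℝ) • mv X')‖⁻¹) • Ac i ((1 / 3 : ℝ) • mv X') = -((‖Ac i ((1 / 3 : ℝ) • mv X)‖⁻¹) • Ac i ((1 / 3 : ℝ) • mv X))) ∨
      |⟪(‖Ac i ((1 / 3 : ℝ) • mv X)‖⁻¹) • Ac i ((1 / 3 : ℝ) • mv X),
          (‖Ac i ((1 / 3 : ℝ) • mv X')‖⁻¹) • Ac i ((1 / 3 : ℝ) • mv X')⟫_ℝ| ≤ 1 / 3 + 246 / 10 ^ 5 := by
  have hLi : ListedBy (Pc i) fccL := by rw [hPi]; exact listedBy_fcc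
  rcases XF_pairs_eq X hX X' hX' with rfl | rfl | hd
  · exact Or.inl (Or.inl rfl)
  · exact Or.inl (Or.inr (unit_third_tneg _ _))
  · exact Or.inr (pair_cos_le hA hi hLi (List.all_eq_true.1 ownFace_table.1 X hX) (List.all_eq_true.1 ownFace_table.1 X' hX')
      (star_lists_shape.1 X hX) (star_lists_shape.1 X' hX') hd)

omit hy hP hA hf hinj hex in
/-- ★ **KILL READING FROM TWO ALIGNED LEGS.**  Unit vectors `û, û′` within `δ, δ′` of `±N_m, ±N_{m′}` (`N_{m′}` a unit axis) with `|⟪û, û′⟫| ≤ c₀` give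
`|⟪N_m, N_{m′}⟫| ≤ c₀ + δ + δ′` — `inner_near_axes` read from the legs' side (the hub kill: `c₀ = 1/3 + 246/10⁵`, `δ + δ′ ≤ 34·33/10⁵` ⇒
`0.3470133 ≤ 87/250`). [this file · glue over `…RunCutSheetCrossing.inner_near_axes`] -/
theorem legs_cross {û û' nm nm' : E3} {σ σ' δ δ' c₀ : ℝ} (hû : ‖û‖ = 1) (hnm' : ‖nm'‖ = 1) (hσ : σ = 1 ∨ σ = -1) (hσ' : σ' = 1 ∨ σ' = -1)
    (h : ‖û - σ • nm‖ ≤ δ) (h' : ‖û' - σ' • nm'‖ ≤ δ') (hc : |⟪û, û'⟫_ℝ| ≤ c₀) : |⟪nm, nm'⟫_ℝ| ≤ c₀ + δ + δ' :=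
  inner_near_axes hû hnm' hσ hσ' (axis_flip hσ h) (axis_flip hσ' h') hc

end Atlas

end Summit.AtomisticToContinuum.Crystallization.Theorems.OverbindingBudgetAffineRunCutLeg
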